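import Summits.CriticalPhenomena.CardyFormulaZ2.Theorems.CardyUniqueLimitCardyRigidityMvpBootstrap
import Summits.CriticalPhenomena.CardyFormulaZ2.Theorems.CardyUniqueLimitCardyRigidityAffineBeta

/-!
# Affine-Cardy rigidity from asymptotic mean-value data (line `crossing-martingale`, crux `CardyRigidity`)

Pure real analysis, theorems only; third and last file of the ANALYSIS half of the unified stub
`stub_kernelAffineCardy` (crux `CardyRigidity`, stmt-CriticalPhenomena-0746; lead
`prover-line-stmt-CriticalPhenomena-0746-0`).

THEOREM (`Mvp.affineCardy_of_mvpData`, registered glue `affineCardy_of_mvpData`).  Let `f` be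
continuous on `(0,1)` and let `m, v` be reals with `v ≥ 0` (the first two moments `E W₁`, `E W₁²` of a
regular driving process).  Suppose that for EVERY mark shape `0 < a < b < c`, with modulus
`η̂ = cardyEta a b c`, `S₁ = (c-b)(b-a)/((c-a)b²)`, `c₁' = -2(c-b)(b-a)/((c-a)b³)`, `Σ = a⁻¹+b⁻¹+c⁻¹`,
there are probability measures `ν_n` on `ℝ` carried by `[-r_n, r_n]`, `r_n → 0`, with
`∫ f(η̂ + x) dν_n = f η̂` exactly, `n ∫x dν_n → -S₁ m`, `n² ∫x² dν_n → S₁² v`, and, if `m = 0`,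
`n² ∫x dν_n → 2 Σ S₁ + (v/2) c₁'` (the limits are quantified as reals `L₁, L₂, M₁` tied to these
values by equations, so that any algebraically equivalent spelling of the constants plugs in; this is
what the far-field expansion of the level-stopped crossing martingales delivers: the laws of the
increment of the stopped modulus at mark scale `n`).  Then `f = A·I_{2/3} + B` on `(0,1)`.

Proof.  `m ≠ 0`: first-order viscosity rigidity (`Mvp.const_of_first_order`) makes `f` constant.
`m = 0`, `v = 0`: the second order degenerates to first order (`Mvp.const_of_second_order_degenerate`),
`f` constant.  `m = 0`, `v > 0`: along the base family `(2η/(1+η), 1, 2)` of each modulus `η` the data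
are a viscosity formulation of `A f'' + B f' = 0` with `A = v(1-η)²/8 > 0`, so `f ∈ C^∞(0,1)`
(`Mvp.contDiffOn_of_second_order`); then the second-order identities hold EXACTLY at every shape
(`Mvp.identity_of_contDiffOn`), and at the two bases `(2η/(1+η),1,2)`, `(4η/(η+3),1,4)` of a modulus
they are the generator equations of `AffineBeta.algebra_step`: `(6 - v) f' = 0` and, at `v = 6`,
Cardy's equation; `AffineBeta.affine_cardy_of_ode` integrates it.
-/

noncomputable section

open MeasureTheory Filter Set Topology
open scoped BigOperators ContDiff
open Literature.Probability.RandomPlanarGeometry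

namespace Summit.CriticalPhenomena.CardyFormulaZ2.Cruxes.CardyRigidity.CrossingMartingale

namespace Mvp

/-! ### Derivatives of a kernel smooth on `(0,1)` -/

/-- A kernel `C^∞` on `(0,1)` has `f' = deriv f`, `(deriv f)' = deriv (deriv f)` at interior points.
[folklore] -/
theorem hasDerivAt_of_contDiffOn {f : ℝ → ℝ} (hfs : ContDiffOn ℝ ∞ f (Ioo 0 1)) {η : ℝ}
    (hη : η ∈ Ioo (0 : ℝ) 1) :
    HasDerivAt f (deriv f η) η ∧ HasDerivAt (deriv f) (deriv (deriv f) η) η := by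
  obtain ⟨φ, hφ, hφf⟩ := Literature.Analysis.ODE.exists_contDiff_eventuallyEq
    (Ioo_mem_nhds hη.1 hη.2) hfs
  obtain ⟨hd1, hd2, -⟩ := derivs_of_contDiff hφ
  have hfφ : f =ᶠ[𝓝 η] φ := hφf.symm
  have hdfφ : deriv f =ᶠ[𝓝 η] deriv φ := hfφ.deriv
  constructor
  · have h := (hd1 η).congr_of_eventuallyEq hfφ
    rwa [← hfφ.deriv_eq] at h
  · have h := (hd2 η).congr_of_eventuallyEq hdfφ
    rwa [← hdfφ.deriv_eq] at h

/-! ### The base family of a modulus -/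

/-- Along the base family `a(η) = 2η/(1+η)`, `b = 1`, `c = 2`: the coefficient functions
`A η = v (1-η)²/8` and `B η = (1+4η)(1-η)/(2η) - v(1-η)/2` are smooth on `(0,1)` and `A > 0` for
`v > 0`. [folklore] -/
theorem base_coefficients_smooth (v : ℝ) :
    ContDiffOn ℝ ∞ (fun η : ℝ ↦ v * (1 - η) ^ 2 / 8) (Ioo 0 1) ∧
      ContDiffOn ℝ ∞ (fun η : ℝ ↦ (1 + 4 * η) * (1 - η) / (2 * η) - v * (1 - η) / 2) (Ioo 0 1) := by
  constructor
  · exact ((contDiff_const.mul ((contDiff_const.sub contDiff_id).pow 2)).div_const _).contDiffOn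
  · refine ContDiffOn.sub ?_ ?_
    · refine ContDiffOn.div ?_ ?_ ?_
      · exact ((contDiff_const.add (contDiff_const.mul contDiff_id)).mul
          (contDiff_const.sub contDiff_id)).contDiffOn
      · exact (contDiff_const.mul contDiff_id).contDiffOn
      · intro η hη; exact mul_ne_zero two_ne_zero hη.1.ne'
    · exact ((contDiff_const.mul (contDiff_const.sub contDiff_id)).div_const _).contDiffOn

/-! ### The main theorem -/

/-- **Affine-Cardy rigidity from asymptotic mean-value data** (see the module docstring).
[cite: LawlerSchrammWerner2001, §3] [cite: Cardy1992, eq. (8)] -/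
theorem affineCardy_of_mvpData {f : ℝ → ℝ} (hf : ContinuousOn f (Ioo 0 1)) {m v : ℝ} (hv : 0 ≤ v)
    (hdata : ∀ a b c : ℝ, 0 < a → a < b → b < c →
      ∃ (r : ℕ → ℝ) (ν : ℕ → Measure ℝ) (L₁ L₂ M₁ : ℝ), Tendsto r atTop (𝓝 0) ∧
        (∀ᶠ n in atTop, IsProbabilityMeasure (ν n) ∧ ν n (Icc (-(r n)) (r n))ᶜ = 0 ∧
          ∫ x, f (cardyEta a b c + x) ∂(ν n) = f (cardyEta a b c)) ∧
        Tendsto (fun n : ℕ ↦ (n : ℝ) * ∫ x, x ∂(ν n)) atTop (𝓝 L₁) ∧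
        Tendsto (fun n : ℕ ↦ (n : ℝ) ^ 2 * ∫ x, x ^ 2 ∂(ν n)) atTop (𝓝 L₂) ∧
        (m = 0 → Tendsto (fun n : ℕ ↦ (n : ℝ) ^ 2 * ∫ x, x ∂(ν n)) atTop (𝓝 M₁)) ∧
        L₁ = -((c - b) * (b - a) / ((c - a) * b ^ 2)) * m ∧
        L₂ = ((c - b) * (b - a) / ((c - a) * b ^ 2)) ^ 2 * v ∧
        M₁ = 2 * (a⁻¹ + b⁻¹ + c⁻¹) * ((c - b) * (b - a) / ((c - a) * b ^ 2)) +
            v / 2 * (-2 * ((c - b) * (b - a)) / ((c - a) * b ^ 3))) :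
    ∃ A B : ℝ, EqOn f (fun η ↦ A * betaLaw (2 / 3) η + B) (Ioo 0 1) := by
  -- integrability of `f(η̂ + ·)` and the identity in the `Mvp` format, from continuity and support
  have hidof : ∀ {η₀ : ℝ}, η₀ ∈ Ioo (0 : ℝ) 1 → ∀ {r : ℕ → ℝ} {ν : ℕ → Measure ℝ},
      Tendsto r atTop (𝓝 0) →
      (∀ᶠ n in atTop, IsProbabilityMeasure (ν n) ∧ ν n (Icc (-(r n)) (r n))ᶜ = 0 ∧
        ∫ x, f (η₀ + x) ∂(ν n) = f η₀) →
      (∀ᶠ n in atTop, IsProbabilityMeasure (ν n) ∧ ν n (Icc (-(r n)) (r n))ᶜ = 0) ∧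
      (∀ᶠ n in atTop, Integrable (fun x ↦ f (η₀ + x)) (ν n) ∧ f η₀ = ∫ x, f (η₀ + x) ∂(ν n)) := by
    intro η₀ hη₀ r ν hr hν
    refine ⟨hν.mono fun n hn ↦ ⟨hn.1, hn.2.1⟩, ?_⟩
    set ρ : ℝ := min η₀ (1 - η₀) / 2 with hρ
    have hρpos : 0 < ρ := by
      have : 0 < min η₀ (1 - η₀) := lt_min hη₀.1 (by linarith [hη₀.2])
      rw [hρ]; linarith
    have hρ1 : ρ ≤ η₀ / 2 := by
      rw [hρ]; linarith [min_le_left η₀ (1 - η₀)]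
    have hρ2 : ρ ≤ (1 - η₀) / 2 := by
      rw [hρ]; linarith [min_le_right η₀ (1 - η₀)]
    have hsub : Icc (η₀ - ρ) (η₀ + ρ) ⊆ Ioo 0 1 := fun y hy ↦
      ⟨by linarith [hy.1, hη₀.1], by linarith [hy.2, hη₀.2]⟩
    have hcont : ContinuousOn f (Icc (η₀ - ρ) (η₀ + ρ)) := hf.mono hsub
    have hrρ : ∀ᶠ n in atTop, r n < ρ := hr.eventually (gt_mem_nhds hρpos)
    filter_upwards [hν, hrρ] with n hn hrn
    obtain ⟨hprob, hsupp, hid⟩ := hn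
    exact ⟨KernelODE.integrable_shift_of_continuousOn hcont hrn.le hsupp, hid.symm⟩
  have one_half : (1 / 2 : ℝ) ∈ Ioo (0 : ℝ) 1 := ⟨by norm_num, by norm_num⟩
  -- packaging of the constant case
  have hconst_out : (∀ x ∈ Ioo (0 : ℝ) 1, ∀ y ∈ Ioo (0 : ℝ) 1, f x = f y) →
      ∃ A B : ℝ, EqOn f (fun η ↦ A * betaLaw (2 / 3) η + B) (Ioo 0 1) := fun h ↦
    ⟨0, f (1 / 2), fun η hη ↦ by simp [h η hη (1 / 2) one_half]⟩
  -- the data at the base shape `(2η/(1+η), 1, 2)` of a modulus `η`, split into the pieces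
  have hbase : ∀ η₀ ∈ Ioo (0 : ℝ) 1, ∃ (r : ℕ → ℝ) (ν : ℕ → Measure ℝ), Tendsto r atTop (𝓝 0) ∧
      (∀ᶠ n in atTop, IsProbabilityMeasure (ν n) ∧ ν n (Icc (-(r n)) (r n))ᶜ = 0) ∧
      (∀ᶠ n in atTop, Integrable (fun x ↦ f (η₀ + x)) (ν n) ∧ f η₀ = ∫ x, f (η₀ + x) ∂(ν n)) ∧
      Tendsto (fun n : ℕ ↦ (n : ℝ) * ∫ x, x ∂(ν n)) atTop (𝓝 (-((1 - η₀) / 2) * m)) ∧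
      Tendsto (fun n : ℕ ↦ (n : ℝ) ^ 2 * ∫ x, x ^ 2 ∂(ν n)) atTop (𝓝 (((1 - η₀) / 2) ^ 2 * v)) ∧
      (m = 0 → Tendsto (fun n : ℕ ↦ (n : ℝ) ^ 2 * ∫ x, x ∂(ν n)) atTop
        (𝓝 ((2 + 8 * η₀) / η₀ / 2 * ((1 - η₀) / 2) + v / 2 * (-(1 - η₀))))) := by
    intro η₀ hη₀
    obtain ⟨ha0, ha1, hG, hc₁, hc₁', hw⟩ := AffineBeta.base_half_values hη₀
    obtain ⟨r, ν, L₁, L₂, M₁, hr, hν, h1, h2, h3, e1, e2, e3⟩ :=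
      hdata (2 * η₀ / (1 + η₀)) 1 2 ha0 ha1 (by norm_num)
    subst e1 e2 e3
    rw [hG] at hν
    obtain ⟨hν', hid⟩ := hidof hη₀ hr hν
    rw [hc₁] at h1 h2 h3
    rw [hc₁'] at h3
    have hw2 : 2 * ((2 * η₀ / (1 + η₀))⁻¹ + 1⁻¹ + 2⁻¹) = (2 + 8 * η₀) / η₀ / 2 := by
      rw [← hw]; ring
    rw [hw2] at h3
    exact ⟨r, ν, hr, hν', hid, h1, h2, h3⟩
  -- CASE `m ≠ 0`: first-order rigidity
  by_cases hm : m = 0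
  swap
  · refine hconst_out (const_of_first_order hf hm fun η₀ hη₀ ↦ ?_)
    obtain ⟨r, ν, hr, hν, hid, h1, h2, -⟩ := hbase η₀ hη₀
    exact ⟨(1 - η₀) / 2, ((1 - η₀) / 2) ^ 2 * v, r, ν, by linarith [hη₀.2], hr, hν, hid, h1, h2⟩
  -- from now on `m = 0`
  rcases hv.eq_or_lt with hv0 | hvpos
  · -- CASE `v = 0`: degenerate second order
    refine hconst_out (const_of_second_order_degenerate hf fun η₀ hη₀ ↦ ?_)
    obtain ⟨r, ν, hr, hν, hid, -, h2, h3⟩ := hbase η₀ hη₀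
    have h3' := h3 hm
    rw [← hv0] at h2 h3'
    refine ⟨(2 + 8 * η₀) / η₀ / 2 * ((1 - η₀) / 2) + 0 / 2 * (-(1 - η₀)), r, ν, ?_, hr, hν, hid,
      h3', by simpa using h2⟩
    have h0 : 0 < η₀ := hη₀.1
    have h1 : 0 < 1 - η₀ := by linarith [hη₀.2]
    have : 0 < (2 + 8 * η₀) / η₀ / 2 * ((1 - η₀) / 2) := by positivity
    linarith
  -- CASE `v > 0`: the bootstrap to `C^∞`
  set Acoef : ℝ → ℝ := fun η ↦ v * (1 - η) ^ 2 / 8 with hA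
  set Bcoef : ℝ → ℝ := fun η ↦ (1 + 4 * η) * (1 - η) / (2 * η) - v * (1 - η) / 2 with hB
  obtain ⟨hAs, hBs⟩ := base_coefficients_smooth v
  have hApos : ∀ η ∈ Ioo (0 : ℝ) 1, 0 < Acoef η := by
    intro η hη
    have h1 : 0 < 1 - η := by linarith [hη.2]
    simp only [hA]
    positivity
  have hfs : ContDiffOn ℝ ∞ f (Ioo 0 1) := by
    refine (contDiffOn_of_second_order hf hAs hBs hApos fun η₀ hη₀ ↦ ?_).1
    obtain ⟨r, ν, hr, hν, hid, -, h2, h3⟩ := hbase η₀ hη₀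
    have h3' := h3 hm
    have hη0 : η₀ ≠ 0 := hη₀.1.ne'
    have eB : (2 + 8 * η₀) / η₀ / 2 * ((1 - η₀) / 2) + v / 2 * (-(1 - η₀)) = Bcoef η₀ := by
      simp only [hB]; field_simp; ring
    have eA : ((1 - η₀) / 2) ^ 2 * v = 2 * Acoef η₀ := by
      simp only [hA]; ring
    rw [eB] at h3'
    rw [eA] at h2
    exact ⟨r, ν, hr, hν, hid, h3', h2⟩
  -- the exact second-order identity at EVERY shape
  have hident : ∀ a b c : ℝ, 0 < a → a < b → b < c →
      deriv f (cardyEta a b c) *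
          (2 * (a⁻¹ + b⁻¹ + c⁻¹) * ((c - b) * (b - a) / ((c - a) * b ^ 2)) +
            v / 2 * (-2 * ((c - b) * (b - a)) / ((c - a) * b ^ 3))) +
        deriv (deriv f) (cardyEta a b c) / 2 * (((c - b) * (b - a) / ((c - a) * b ^ 2)) ^ 2 * v)
        = 0 := by
    intro a b c ha hab hbc
    obtain ⟨r, ν, L₁, L₂, M₁, hr, hν, -, h2, h3, -, e2, e3⟩ := hdata a b c ha hab hbc
    subst e2 e3
    obtain ⟨hν', hid⟩ := hidof (cardyEta_mem_Ioo ha hab hbc) hr hν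
    exact identity_of_contDiffOn hfs (cardyEta_mem_Ioo ha hab hbc) hr hν' hid (h3 hm) h2
  -- the elimination at every modulus
  have helim : ∀ η ∈ Ioo (0 : ℝ) 1, (6 - v) * deriv f η = 0 ∧
      (v = 6 → 3 * η * (1 - η) * deriv (deriv f) η + 2 * (1 - 2 * η) * deriv f η = 0) := by
    intro η hη
    obtain ⟨ha0, ha1, hGa, hc₁, hc₁', hw⟩ := AffineBeta.base_half_values hη
    obtain ⟨hb0, hb1, hGb, hd₁, hd₁', hw'⟩ := AffineBeta.base_quarter_values hη
    have I₁ := hident (2 * η / (1 + η)) 1 2 ha0 ha1 (by norm_num)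
    have I₂ := hident (4 * η / (η + 3)) 1 4 hb0 hb1 (by norm_num)
    rw [hGa, hc₁, hc₁'] at I₁
    rw [hGb, hd₁, hd₁'] at I₂
    refine AffineBeta.algebra_step hη ?_ ?_
    · linear_combination 2 * I₁ - (deriv f η * ((1 - η) / 2)) * hw
    · linear_combination 2 * I₂ - (deriv f η * (3 * (1 - η) / 4)) * hw'
  -- conclusion
  by_cases hall : ∀ η ∈ Ioo (0 : ℝ) 1, deriv f η = 0
  · -- `f' ≡ 0`: constant kernel
    refine ⟨0, f (1 / 2), fun η hη ↦ ?_⟩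
    simp only [zero_mul, zero_add]
    exact isOpen_Ioo.is_const_of_deriv_eq_zero isPreconnected_Ioo
      (fun x hx ↦ (hasDerivAt_of_contDiffOn hfs hx).1.differentiableAt.differentiableWithinAt)
      (fun x hx ↦ hall x hx) hη one_half
  · push Not at hall
    obtain ⟨η₀, hη₀, hne⟩ := hall
    have hv6 : v = 6 := by
      have := (helim η₀ hη₀).1
      rcases mul_eq_zero.1 this with h6 | h6
      · linarith
      · exact absurd h6 hne
    obtain ⟨A, B, hAB⟩ := AffineBeta.affine_cardy_of_ode (f₁ := deriv f) (f₂ := deriv (deriv f))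
      (fun η hη ↦ (hasDerivAt_of_contDiffOn hfs hη).1) (fun η hη ↦ (hasDerivAt_of_contDiffOn hfs hη).2)
      (fun η hη ↦ (helim η hη).2 hv6)
    refine ⟨A, B, fun η hη ↦ ?_⟩
    rw [hAB hη]
    simp only [AffineBeta.cardyFunction_eq_betaLaw hη]

/-- **Registered form** (glue sub-goal `mvp_affineCardy_of_mvpData` of stmt-CriticalPhenomena-0746): the
ANALYSIS half of `stub_kernelAffineCardy` — asymptotic mean-value data at every mark shape force a
continuous kernel to be affine in Cardy's `I_{2/3}` on `(0,1)`.
[cite: LawlerSchrammWerner2001, §3] [cite: Cardy1992, eq. (8)] -/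
theorem mvp_affineCardy_of_mvpData : ∀ {f : ℝ → ℝ}, ContinuousOn f (Set.Ioo 0 1) → ∀ {m v : ℝ}, 0 ≤ v → (∀ a b c : ℝ, 0 < a → a < b → b < c → ∃ (r : ℕ → ℝ) (ν : ℕ → MeasureTheory.Measure ℝ) (L₁ L₂ M₁ : ℝ), Filter.Tendsto r Filter.atTop (nhds 0) ∧ (∀ᶠ n in Filter.atTop, MeasureTheory.IsProbabilityMeasure (ν n) ∧ ν n (Set.Icc (-(r n)) (r n))ᶜ = 0 ∧ ∫ x, f (cardyEta a b c + x) ∂(ν n) = f (cardyEta a b c)) ∧ Filter.Tendsto (fun n : ℕ ↦ (n : ℝ) * ∫ x, x ∂(ν n)) Filter.atTop (nhds L₁) ∧ Filter.Tendsto (fun n : ℕ ↦ (n : ℝ) ^ 2 * ∫ x, x ^ 2 ∂(ν n)) Filter.atTop (nhds L₂) ∧ (m = 0 → Filter.Tendsto (fun n : ℕ ↦ (n : ℝ) ^ 2 * ∫ x, x ∂(ν n)) Filter.atTop (nhds M₁)) ∧ L₁ = -((c - b) * (b - a) / ((c - a) * b ^ 2)) * m ∧ L₂ = ((c - b) * (b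 - a) / ((c - a) * b ^ 2)) ^ 2 * v ∧ M₁ = 2 * (a⁻¹ + b⁻¹ + c⁻¹) * ((c - b) * (b - a) / ((c - a) * b ^ 2)) + v / 2 * (-2 * ((c - b) * (b - a)) / ((c - a) * b ^ 3))) → ∃ A B : ℝ, Set.EqOn f (fun η ↦ A * betaLaw (2 / 3) η + B) (Set.Ioo 0 1) :=
  fun hf _ _ hv hdata ↦ affineCardy_of_mvpData hf hv hdata

end Mvp

end Summit.CriticalPhenomena.CardyFormulaZ2.Cruxes.CardyRigidity.CrossingMartingale

end
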